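import Summits.QuantumFields.YangMills.Theorems.UnitScaleTiltProp7QTwSEllTwoPlainTube
import Summits.QuantumFields.YangMills.Theorems.UnitScaleTiltProp7QTwSLocalGaugeComparisonAllFields
import HarnessLib

/-!
# Route `UnitScaleTilt`, crux «MinimiserStabilityRegPr» (stmt-QuantumFields-19200, stub EX), γ-row `hGF[Lift]` (LOD line; w5 g13's (L6) knit ✓`Prop7LODAssembly.curvedTarget_of_LOD_topMean`,
# slot `hK₃` ← routeR-w4 g26) — ★★ THE `ℓ²` OPERATOR BOUND OF THE AVERAGING OPERATOR OF RECORD AT A PRINTED-REGULAR BACKGROUND: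
# `Σ_{c'} |QTwS U₀ B c'|² ≤ 6·(ℓ²∕ℓ^d)·Σ_b |B b|²` (𝔰𝔲(2) fields, operator norm) and `Σ_{c'} ‖QTwS U₀ Y c'‖_HS² ≤ 36·(ℓ²∕ℓ^d)·Σ_b ‖Y b‖_HS²` (all `M₂(ℂ)` fields)

Cell `ym3-torus` (rung R3 — YM₃ on T³; NOT d = 4, NOT the Clay problem).  Width seat `ym-routeR-w4` g26.  THEOREMS ONLY (0 `def`, 0 `sorry`); `--supports stmt-QuantumFields-19200 --as helper`;
count-neutral.  FILE 1b of the `hK₃` pen (1a = ✓`Prop7QTwSEllTwoPlainTube`; 2 = the cutoff commutator).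

THE POINT.  The three-error identity of ✓p751052 read for `G = QTwS U₀ B` itself: per coarse bond, `ℓ^d·G(ĉ) = ℓ^d·(G − S)(ĉ) − Ad_{Φ⁻¹}(T(ĉ) − ℓ^d·Ad_Φ S(ĉ)) + Ad_{Φ⁻¹}T(ĉ)`
((R3) ✓`QTwS_apply_eq_frameReduced_bondShift`; `S` the pure LINE iterate, `T = T^{str}_{U₀}B` the corner tube functional, `Φ(ĉ) ∈ U1` the (iv) frame), so
`ℓ^{2d}Σ|G|² ≤ 3[ℓ^{2d}Σ|G − S|² + Σ|T − ℓ^dAd_ΦS|² + Σ|T|²] ≤ 3[(10¹¹L¹⁰∕16)ε₀² + 1]·ℓ^dℓ²·Σ|B|²` by (R2) ✓`sqrt_sum_normSq_frameReduced_sub_lineIter_le_of_regPr` + ✓`bridgeConst_sq_le`,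
(R1) ✓`sum_normSq_tubeStr_sub_smul_conjR_lineIter_le` and FILE 1a ✓`sum_normSq_tubeStr_le`; the window `10¹⁰L⁶ε₀ ≤ 1` makes `10¹⁰L¹⁰ε₀² ≤ 1`.  All `M₂(ℂ)` fields: sectors
`Y = Y₁ + I•Y₂ + τ•1` (✓`exists_sector_fields`), the scalar sector is flat ((Q-b) ✓`QTwS_smul_one_eq_QTwS_one_of_regPr` + ✓`sum_normSq_QTwS_one_le`), `|X|² ≤ Σ|X_{jk}|² ≤ 2|X|²`, Pythagoras
✓`sum_normSq_entries_sectors`.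
WHAT IS PROVED: `smul_eq_three_terms`, ★★`sum_normSq_QTwS_le_of_su2` (`3·(1 + 10¹⁰L¹⁰ε₀²)`), `ten10_L10_sq_le_one`, ★★`sum_normSq_QTwS_le_six_of_su2`,
★`sum_normSq_entries_QTwS_smul_one_le`, ★★`sum_normSq_entries_QTwS_le` (constant `36`).
HONEST SCOPE.  Bookkeeping over landed rows; `hK₃`, the knit's other slots, `hT`, `hGF`, the print rows, `hThm2S`, EX and the crux are NOT proved here.
References: T. Bałaban, CMP **99** (1985) 389–434 [Balaban1985BackgroundPropagators] ((3.13)–(3.16) p.393, Thm 3.11 p.416); CMP **98** (1985) 17–51 [Balaban1985Averaging]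
((18)–(20) p.21, Prop. 3 (124)–(126) p.36, Prop. 4 (134)–(135) p.38); CMP **95** (1984) 17–40 [Balaban1984PropagatorsI] ((1.18)–(1.20) pp.19–20); CMP **102** (1985) 277–309
[Balaban1985Variational] ((2) p.278, (51) p.286).
-/

set_option autoImplicit false

noncomputable section

open scoped BigOperators Matrix.Norms.L2Operator Matrix

namespace Summit.QuantumFields.YangMills.Theorems.Prop7QTwSEllTwoBound

open Literature.MathematicalPhysics.QuantumFieldTheory.Balaban1983to89
open Literature.MathematicalPhysics.QuantumFieldTheory.Balaban1983to89.T3ContinuumYM3Torus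
open Finset T4Continuum BlockAveraging AveragingRT ExpMeanLog BlockAveragingEMLLinearised BlockAveragingEMLLinearisedBackground BlockAveragingEMLProp2 LatticeFieldCalculus
open B7Prop1Explicit (U1 mem_U1 treeWord expUnit disp)
open B7Eq78Linearization (conjR conjR_apply conjR_sub conjR_smul)
open B8Ineq132 (norm_conjR conjR_conjR one_conjR conjR_sum)
open B10Eq27TorusAxialLog (holT axialT unitsField toUField transl)
open B15DeterminingSets (embIter)
open T3LevelShift (bondShift)
open T3PrintedRegularOrbits (sites_eq)
open T3PrintedRegularMinimiser (RegPr)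
open T3SectALandauChart (bgUnits)
open Summit.QuantumFields.YangMills.Theorems.Prop8Chart (emlIterU)
open Summit.QuantumFields.YangMills.Theorems.Prop7SymAvgTwSym (QTwS holT_mem_U1 unitsField_toUField_mem_U1' QTwS_apply_smul_one_of_regPr
  QTwS_smul_one_eq_QTwS_one_of_regPr)
open Summit.QuantumFields.YangMills.Theorems.Prop7RieszTauFrobNorm (sum_norm_sq_le_two_mul_opNorm_sq)
open Summit.QuantumFields.YangMills.Theorems.Prop7QTwSectors (exists_sector_fields sum_normSq_entries_sectors)
open Summit.QuantumFields.YangMills.Theorems.Prop7TubeStrSubStairLineIter (sum_normSq_tubeStr_sub_smul_conjR_lineIter_le)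
open Summit.QuantumFields.YangMills.Theorems.Prop7TrueLinIterDefectOfStairGauge (sqrt_sum_normSq_frameReduced_sub_lineIter_le_of_regPr)
open Summit.QuantumFields.YangMills.Theorems.Prop7CoarseGaugeEqFrameResponseQTwS (exists_stairGauge_family QTwS_apply_eq_frameReduced_bondShift)
open Summit.QuantumFields.YangMills.Theorems.Prop7TubeComparisonKnitOfRegPr (bridgeConst_sq_le)
open Summit.QuantumFields.YangMills.Theorems.Prop7QTwSLocalGaugeComparisonAllFields (sum_normSq_I_smul)
open Summit.QuantumFields.YangMills.Theorems.Prop7QTwSEllTwoPlainTube (sum_normSq_tubeStr_le sum_normSq_QTwS_one_le normSq_le_three sum_normSq_add_three_le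
  sum_normSq_smul_one)

variable (F : T3Family) (n K : ℕ)

/-! ## §2 The curved bound on 𝔰𝔲(2) fields -/

section Curved

variable (h : n ≤ K)

/-- algebra: `ℓ•G = ℓ•(G − S) − Ad_{Φ⁻¹}(T − ℓ•Ad_Φ S) + Ad_{Φ⁻¹}T` — the three-error identity of ✓p751052 read for `G` itself. [cite: Balaban1985BackgroundPropagators, (3.13)-(3.15) p.393] -/
theorem smul_eq_three_terms (Φ : (Matrix (Fin 2) (Fin 2) ℂ)ˣ) (ld : ℂ) (G S T : Matrix (Fin 2) (Fin 2) ℂ) :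
    ld • G = ld • (G - S) - conjR Φ⁻¹ (T - ld • conjR Φ S) + conjR Φ⁻¹ T := by
  rw [conjR_sub, conjR_smul, conjR_conjR, inv_mul_cancel, one_conjR, smul_sub]
  abel

set_option maxHeartbeats 400000 in
/-- ★★ **THE `ℓ²` BOUND OF THE AVERAGING OPERATOR OF RECORD ON 𝔰𝔲(2) FIELDS AT A PRINTED-REGULAR BACKGROUND**: `RegPr F n K ε₀ U₀`, `10¹⁰L⁶ε₀ ≤ 1`, `10¹²L³ε₀ ≤ 1`, `B` 𝔰𝔲(2)-valued ⟹
`Σ_{c'} |QTwS U₀ B c'|² ≤ 3·(1 + 10¹⁰L¹⁰ε₀²)·(ℓ²∕ℓ^d)·Σ_b |B b|²`.  PROOF: per `c'`, `ℓ^d·QTwS U₀ B c' = ℓ^d·G(ĉ) = ℓ^d·(G − S)(ĉ) − Ad_{Φ⁻¹}(T(ĉ) − ℓ^d·Ad_Φ S(ĉ)) + Ad_{Φ⁻¹}T(ĉ)`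
((R3); `Φ(ĉ) ∈ U1`), squared with `3(·)`, summed: (R2) + ✓`bridgeConst_sq_le`, (R1), §1.
[cite: Balaban1985BackgroundPropagators, (3.13)-(3.15) p.393, Thm 3.11 p.416; Balaban1985Averaging, Prop. 3 (124)-(126) p.36, Prop. 4 (134)-(135) p.38; Balaban1984PropagatorsI, (1.18)-(1.20) pp.19-20] -/
theorem sum_normSq_QTwS_le_of_su2 {ε₀ : ℝ} (hε₀ : 0 < ε₀) (hε : 10 ^ 10 * (F.L : ℝ) ^ 6 * ε₀ ≤ 1) (hε12 : 10 ^ 12 * (F.L : ℝ) ^ 3 * ε₀ ≤ 1)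
    (W : GaugeField (F.P K) 0 (Matrix.specialUnitaryGroup (Fin 2) ℂ)) (hreg : RegPr F n K ε₀ W)
    (B : PBond (F.P K) 0 → Matrix (Fin 2) (Fin 2) ℂ) (hsk : ∀ b, (B b)ᴴ = -B b) (htr : ∀ b, (B b).trace = 0) :
    ∑ c' : PBond (F.P n) 0, ‖QTwS F n K h W B c'‖ ^ 2
      ≤ 3 * (1 + 10 ^ 10 * (F.L : ℝ) ^ 10 * ε₀ ^ 2) * (((F.L : ℝ) ^ (K - n)) ^ 2 / ((F.L : ℝ) ^ (K - n)) ^ (F.P K).d) * ∑ b : PBond (F.P K) 0, ‖B b‖ ^ 2 := by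
  classical
  have hk : K - n ≤ (F.P K).m + (F.P K).K := by show K - n ≤ F.m + K; omega
  have hd : (F.P K).d = 3 := T3Family.P_d F K
  have hLL : ((F.P K).L : ℝ) = F.L := rfl
  have hL3 : (3 : ℝ) ≤ F.L := by
    have h3 : 3 ≤ F.L := by obtain ⟨a, ha⟩ := F.hL.1; have := F.hL.2; omega
    exact_mod_cast h3
  have hL0 : (0 : ℝ) < F.L := by linarith
  have hℓ0 : (0 : ℝ) < (F.L : ℝ) ^ (K - n) := by positivity
  have hℓd0 : (0 : ℝ) < ((F.L : ℝ) ^ (K - n)) ^ (F.P K).d := by positivity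
  have hU1 : ∀ b, (unitsField (toUField W)) b ∈ U1 (Matrix (Fin 2) (Fin 2) ℂ) := fun b => unitsField_toUField_mem_U1' W b
  have hΦ1 : ∀ c : PBond (F.P K) (K - n), (axialT (unitsField (toUField W)) (Site.fibreSite 0 (K - n) c.src fun _ => (⟨0, pow_pos (F.P K).L_pos (K - n)⟩ : Fin ((F.P K).L ^ (K - n)))) (embIter (K - n) c.src)) ∈ U1 (Matrix (Fin 2) (Fin 2) ℂ) := fun c => by unfold axialT; exact holT_mem_U1 hU1 _ _
  have hA : ∀ b, B b ∈ skewAdjoint (Matrix (Fin 2) (Fin 2) ℂ) := fun b => by rw [skewAdjoint.mem_iff]; exact hsk b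
  -- the pure `LINE` family, the true-linearisation family, the stair gauges, the frame-reduced response (as in ✓`Prop7TubeComparisonKnitOfRegPr`)
  let Sf : (k : ℕ) → PBond (F.P K) k → Matrix (Fin 2) (Fin 2) ℂ := fun k =>
    Nat.rec (motive := fun k => PBond (F.P K) k → Matrix (Fin 2) (Fin 2) ℂ) B
      (fun k Sk => fun c => ((Fintype.card (Idx (F.P K)) : ℂ))⁻¹ • ∑ i : Idx (F.P K),
          (((holAt (Averaging.iter (fun i => blockAvg (P := F.P K) (j := i) (expMeanLogSU (n := Fin 2))) k W) (walk (emb c.src) (stairWord i.2.1 (off i.1))) : Matrix.specialUnitaryGroup (Fin 2) ℂ) : Matrix (Fin 2) (Fin 2) ℂ) *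
            covWalkSum (Averaging.iter (fun i => blockAvg (P := F.P K) (j := i) (expMeanLogSU (n := Fin 2))) k W) (Sk)
              (walk (walkEnd (emb c.src) (stairWord i.2.1 (off i.1))) (List.replicate (F.P K).L (c.dir, true))) *
          star ((holAt (Averaging.iter (fun i => blockAvg (P := F.P K) (j := i) (expMeanLogSU (n := Fin 2))) k W) (walk (emb c.src) (stairWord i.2.1 (off i.1))) : Matrix.specialUnitaryGroup (Fin 2) ℂ) : Matrix (Fin 2) (Fin 2) ℂ))) k
  let Qf : (k : ℕ) → (PBond (F.P K) 0 → Matrix (Fin 2) (Fin 2) ℂ) → PBond (F.P K) k → Matrix (Fin 2) (Fin 2) ℂ := fun k =>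
    Nat.rec (motive := fun k => (PBond (F.P K) 0 → Matrix (Fin 2) (Fin 2) ℂ) → PBond (F.P K) k → Matrix (Fin 2) (Fin 2) ℂ) (fun Y => Y)
      (fun k Qk => fun Y c => fderiv ℂ (eml : (Idx (F.P K) → Matrix (Fin 2) (Fin 2) ℂ) → Matrix (Fin 2) (Fin 2) ℂ)
            (fun i => ((loopHol (Averaging.iter (fun i => blockAvg (P := F.P K) (j := i) (expMeanLogSU (n := Fin 2))) k W) c i : Matrix.specialUnitaryGroup (Fin 2) ℂ) : Matrix (Fin 2) (Fin 2) ℂ))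
            (fun i => covWalkSum (Averaging.iter (fun i => blockAvg (P := F.P K) (j := i) (expMeanLogSU (n := Fin 2))) k W) (Qk Y)
                (walk (emb c.src) (loopWord (F.P K).L c.dir (off i.1) i.2.1 i.2.2))
              * ((loopHol (Averaging.iter (fun i => blockAvg (P := F.P K) (j := i) (expMeanLogSU (n := Fin 2))) k W) c i : Matrix.specialUnitaryGroup (Fin 2) ℂ) : Matrix (Fin 2) (Fin 2) ℂ))
            * star ((corr (expMeanLogSU (n := Fin 2)) (Averaging.iter (fun i => blockAvg (P := F.P K) (j := i) (expMeanLogSU (n := Fin 2))) k W) c : Matrix.specialUnitaryGroup (Fin 2) ℂ) : Matrix (Fin 2) (Fin 2) ℂ)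
          + ((corr (expMeanLogSU (n := Fin 2)) (Averaging.iter (fun i => blockAvg (P := F.P K) (j := i) (expMeanLogSU (n := Fin 2))) k W) c : Matrix.specialUnitaryGroup (Fin 2) ℂ) : Matrix (Fin 2) (Fin 2) ℂ)
            * covWalkSum (Averaging.iter (fun i => blockAvg (P := F.P K) (j := i) (expMeanLogSU (n := Fin 2))) k W) (Qk Y)
                (walk (emb c.src) (List.replicate (F.P K).L (c.dir, true)))
            * star ((corr (expMeanLogSU (n := Fin 2)) (Averaging.iter (fun i => blockAvg (P := F.P K) (j := i) (expMeanLogSU (n := Fin 2))) k W) c : Matrix.specialUnitaryGroup (Fin 2) ℂ) : Matrix (Fin 2) (Fin 2) ℂ)) k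
  have hQ0 : ∀ Y, Qf 0 Y = Y := fun _ => rfl
  have hQs : ∀ (k : ℕ) (Y : PBond (F.P K) 0 → Matrix (Fin 2) (Fin 2) ℂ) (c : PBond (F.P K) (k + 1)), Qf (k + 1) Y c
      = fderiv ℂ (eml : (Idx (F.P K) → Matrix (Fin 2) (Fin 2) ℂ) → Matrix (Fin 2) (Fin 2) ℂ)
            (fun i => ((loopHol (Averaging.iter (fun i => blockAvg (P := F.P K) (j := i) (expMeanLogSU (n := Fin 2))) k W) c i : Matrix.specialUnitaryGroup (Fin 2) ℂ) : Matrix (Fin 2) (Fin 2) ℂ))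
            (fun i => covWalkSum (Averaging.iter (fun i => blockAvg (P := F.P K) (j := i) (expMeanLogSU (n := Fin 2))) k W) (Qf k Y)
                (walk (emb c.src) (loopWord (F.P K).L c.dir (off i.1) i.2.1 i.2.2))
              * ((loopHol (Averaging.iter (fun i => blockAvg (P := F.P K) (j := i) (expMeanLogSU (n := Fin 2))) k W) c i : Matrix.specialUnitaryGroup (Fin 2) ℂ) : Matrix (Fin 2) (Fin 2) ℂ))
            * star ((corr (expMeanLogSU (n := Fin 2)) (Averaging.iter (fun i => blockAvg (P := F.P K) (j := i) (expMeanLogSU (n := Fin 2))) k W) c : Matrix.specialUnitaryGroup (Fin 2) ℂ) : Matrix (Fin 2) (Fin 2) ℂ)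
          + ((corr (expMeanLogSU (n := Fin 2)) (Averaging.iter (fun i => blockAvg (P := F.P K) (j := i) (expMeanLogSU (n := Fin 2))) k W) c : Matrix.specialUnitaryGroup (Fin 2) ℂ) : Matrix (Fin 2) (Fin 2) ℂ)
            * covWalkSum (Averaging.iter (fun i => blockAvg (P := F.P K) (j := i) (expMeanLogSU (n := Fin 2))) k W) (Qf k Y)
                (walk (emb c.src) (List.replicate (F.P K).L (c.dir, true)))
            * star ((corr (expMeanLogSU (n := Fin 2)) (Averaging.iter (fun i => blockAvg (P := F.P K) (j := i) (expMeanLogSU (n := Fin 2))) k W) c : Matrix.specialUnitaryGroup (Fin 2) ℂ) : Matrix (Fin 2) (Fin 2) ℂ) := fun _ _ _ => rfl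
  obtain ⟨Λ, hΛ0, hΛs⟩ := exists_stairGauge_family F (K := K) W B
  let G : PBond (F.P K) (K - n) → Matrix (Fin 2) (Fin 2) ℂ := fun c =>
    ((fderiv ℂ (fun t : PBond (F.P K) 0 → Matrix (Fin 2) (Fin 2) ℂ =>
                (((emlIterU (K - n) (fun b' => expUnit (t b') * bgUnits F K W b') c : (Matrix (Fin 2) (Fin 2) ℂ)ˣ) : Matrix (Fin 2) (Fin 2) ℂ))) 0 B
              * star ((Averaging.iter (fun i => blockAvg (P := F.P K) (j := i) (expMeanLogSU (n := Fin 2))) (K - n) W c : Matrix.specialUnitaryGroup (Fin 2) ℂ) : Matrix (Fin 2) (Fin 2) ℂ))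
          - (Λ (K - n) c.src - ((Averaging.iter (fun i => blockAvg (P := F.P K) (j := i) (expMeanLogSU (n := Fin 2))) (K - n) W c : Matrix.specialUnitaryGroup (Fin 2) ℂ) : Matrix (Fin 2) (Fin 2) ℂ) * Λ (K - n) c.tgt * star ((Averaging.iter (fun i => blockAvg (P := F.P K) (j := i) (expMeanLogSU (n := Fin 2))) (K - n) W c : Matrix.specialUnitaryGroup (Fin 2) ℂ) : Matrix (Fin 2) (Fin 2) ℂ)))
  -- (R3): `QTwS W B c' = G ĉ`
  have hR3 : ∀ c' : PBond (F.P n) 0, QTwS F n K h W B c' = G (bondShift (sites_eq F n K h) c') := fun c' =>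
    QTwS_apply_eq_frameReduced_bondShift F h hε₀ hε hε12 W hreg Qf hQ0 hQs B hA htr Λ hΛ0 (fun k _ y => hΛs k y) c'
  -- (R2): `Σ_c ‖G c − S c‖² ≤ E₂'·Σ‖B‖²` and `16ℓ^{2d}E₂' ≤ (10¹¹L¹⁰ − 16·10⁹L⁴)ε₀²ℓ^dℓ²`
  set ρ : ℝ := Real.sqrt ((((F.P K).L : ℝ) ^ (F.P K).d)⁻¹ * ((F.P K).L : ℝ) ^ 2) with hρ
  set κ : ℝ := (159 * ((((F.P K).d + 2) * (F.P K).L : ℕ) : ℝ) * Real.sqrt (2 * (F.P K).d * ((F.P K).L : ℝ) ^ (F.P K).d * (2 * (F.P K).d))) with hκ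
  set Bc : ℝ := (((((F.P K).d + 2) * (F.P K).L : ℕ) : ℝ) ^ 2 / 16 * ε₀) with hBc
  have hρ0 : 0 < ρ := by rw [hρ]; exact Real.sqrt_pos.mpr (by have := (F.P K).L_pos; positivity)
  obtain ⟨h1, -⟩ := sqrt_sum_normSq_frameReduced_sub_lineIter_le_of_regPr F hε₀ hε hε12 W hreg Qf hQ0 hQs B hA htr Λ hΛ0
    (fun k _ y => hΛs k y) Sf (fun _ => rfl) (fun _ _ => rfl) (k := K - n) le_rfl
  rw [← hρ, ← hκ, ← hBc] at h1
  have hS2 : 0 ≤ ∑ c : PBond (F.P K) (K - n), ‖G c - Sf (K - n) c‖ ^ 2 := by positivity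
  have hN : 0 ≤ ∑ b : PBond (F.P K) 0, ‖B b‖ ^ 2 := by positivity
  have h2 : Real.sqrt (∑ c : PBond (F.P K) (K - n), ‖G c - Sf (K - n) c‖ ^ 2)
      ≤ (ρ⁻¹ * (ρ ^ (K - n) * κ * Bc * Real.exp (κ / ρ * Bc))) * Real.sqrt (∑ b : PBond (F.P K) 0, ‖B b‖ ^ 2) := by
    have h' := mul_le_mul_of_nonneg_left h1 (inv_nonneg.mpr hρ0.le)
    rw [← mul_assoc, inv_mul_cancel₀ hρ0.ne', one_mul, ← mul_assoc] at h'
    exact h'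
  have hR2 := pow_le_pow_left₀ (Real.sqrt_nonneg _) h2 2
  rw [Real.sq_sqrt hS2, mul_pow, Real.sq_sqrt hN] at hR2
  have hbc := bridgeConst_sq_le F n K hε₀ hε
  rw [← hρ, ← hκ, ← hBc] at hbc
  -- (R1): the (iv) row in op-norm letters
  have hR1 := sum_normSq_tubeStr_sub_smul_conjR_lineIter_le F hε₀ hε W hreg B Sf (fun _ => rfl) (fun _ _ => rfl)
  -- §1 for `T`
  have hT := sum_normSq_tubeStr_le F n K (unitsField (toUField W)) hU1 B
  -- ★ per coarse bond `c'`
  have hper : ∀ c' : PBond (F.P n) 0, ‖QTwS F n K h W B c'‖ ^ 2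
      ≤ ((((F.L : ℝ) ^ (K - n)) ^ (F.P K).d) ^ 2)⁻¹ * (3 * (‖(((((F.L : ℝ) ^ (K - n)) ^ (F.P K).d : ℝ)) : ℂ) • (G (bondShift (sites_eq F n K h) c') - Sf (K - n) (bondShift (sites_eq F n K h) c'))‖ ^ 2
          + ‖(∑ r : Fin (F.P K).d → Fin ((F.P K).L ^ (K - n)), ∑ t ∈ Finset.range ((F.P K).L ^ (K - n)),
        conjR (holT (unitsField (toUField W)) (Site.fibreSite 0 (K - n) (bondShift (sites_eq F n K h) c').src fun _ => (⟨0, pow_pos (F.P K).L_pos (K - n)⟩ : Fin ((F.P K).L ^ (K - n)))) (treeWord fun ν => ((r ν : ℕ) : ℤ))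
            * holT (unitsField (toUField W)) (Site.fibreSite 0 (K - n) (bondShift (sites_eq F n K h) c').src r) (List.replicate t ((bondShift (sites_eq F n K h) c').dir, true)))
          (B ⟨(fun z : Site (F.P K) 0 => z.shift (bondShift (sites_eq F n K h) c').dir)^[t] (Site.fibreSite 0 (K - n) (bondShift (sites_eq F n K h) c').src r), (bondShift (sites_eq F n K h) c').dir⟩)) - (((((F.L : ℝ) ^ (K - n)) ^ (F.P K).d : ℝ)) : ℂ) • conjR (axialT (unitsField (toUField W)) (Site.fibreSite 0 (K - n) (bondShift (sites_eq F n K h) c').src fun _ => (⟨0, pow_pos (F.P K).L_pos (K - n)⟩ : Fin ((F.P K).L ^ (K - n)))) (embIter (K - n) (bondShift (sites_eq F n K h) c').src)) (Sf (K - n) (bondShift (sites_eq F n K h) c'))‖ ^ 2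
          + ‖(∑ r : Fin (F.P K).d → Fin ((F.P K).L ^ (K - n)), ∑ t ∈ Finset.range ((F.P K).L ^ (K - n)),
        conjR (holT (unitsField (toUField W)) (Site.fibreSite 0 (K - n) (bondShift (sites_eq F n K h) c').src fun _ => (⟨0, pow_pos (F.P K).L_pos (K - n)⟩ : Fin ((F.P K).L ^ (K - n)))) (treeWord fun ν => ((r ν : ℕ) : ℤ))
            * holT (unitsField (toUField W)) (Site.fibreSite 0 (K - n) (bondShift (sites_eq F n K h) c').src r) (List.replicate t ((bondShift (sites_eq F n K h) c').dir, true)))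
          (B ⟨(fun z : Site (F.P K) 0 => z.shift (bondShift (sites_eq F n K h) c').dir)^[t] (Site.fibreSite 0 (K - n) (bondShift (sites_eq F n K h) c').src r), (bondShift (sites_eq F n K h) c').dir⟩))‖ ^ 2)) := by
    intro c'
    have hΦ := hΦ1 (bondShift (sites_eq F n K h) c')
    have hΦi : (axialT (unitsField (toUField W)) (Site.fibreSite 0 (K - n) (bondShift (sites_eq F n K h) c').src fun _ => (⟨0, pow_pos (F.P K).L_pos (K - n)⟩ : Fin ((F.P K).L ^ (K - n)))) (embIter (K - n) (bondShift (sites_eq F n K h) c').src))⁻¹ ∈ U1 (Matrix (Fin 2) (Fin 2) ℂ) := (U1 _).inv_mem hΦ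
    -- the identity `ℓ^d·G = ℓ^d·(G − S) − Ad_{Φ⁻¹}(T − ℓ^d·Ad_Φ S) + Ad_{Φ⁻¹}T`
    have hid : (((((F.L : ℝ) ^ (K - n)) ^ (F.P K).d : ℝ)) : ℂ) • G (bondShift (sites_eq F n K h) c')
        = (((((F.L : ℝ) ^ (K - n)) ^ (F.P K).d : ℝ)) : ℂ) • (G (bondShift (sites_eq F n K h) c') - Sf (K - n) (bondShift (sites_eq F n K h) c'))
          - conjR (axialT (unitsField (toUField W)) (Site.fibreSite 0 (K - n) (bondShift (sites_eq F n K h) c').src fun _ => (⟨0, pow_pos (F.P K).L_pos (K - n)⟩ : Fin ((F.P K).L ^ (K - n)))) (embIter (K - n) (bondShift (sites_eq F n K h) c').src))⁻¹ ((∑ r : Fin (F.P K).d → Fin ((F.P K).L ^ (K - n)), ∑ t ∈ Finset.range ((F.P K).L ^ (K - n)),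
        conjR (holT (unitsField (toUField W)) (Site.fibreSite 0 (K - n) (bondShift (sites_eq F n K h) c').src fun _ => (⟨0, pow_pos (F.P K).L_pos (K - n)⟩ : Fin ((F.P K).L ^ (K - n)))) (treeWord fun ν => ((r ν : ℕ) : ℤ))
            * holT (unitsField (toUField W)) (Site.fibreSite 0 (K - n) (bondShift (sites_eq F n K h) c').src r) (List.replicate t ((bondShift (sites_eq F n K h) c').dir, true)))
          (B ⟨(fun z : Site (F.P K) 0 => z.shift (bondShift (sites_eq F n K h) c').dir)^[t] (Site.fibreSite 0 (K - n) (bondShift (sites_eq F n K h) c').src r), (bondShift (sites_eq F n K h) c').dir⟩)) - (((((F.L : ℝ) ^ (K - n)) ^ (F.P K).d : ℝ)) : ℂ) • conjR (axialT (unitsField (toUField W)) (Site.fibreSite 0 (K - n) (bondShift (sites_eq F n K h) c').src fun _ => (⟨0, pow_pos (F.P K).L_pos (K - n)⟩ : Fin ((F.P K).L ^ (K - n)))) (embIter (K - n) (bondShift (sites_eq F n K h) c').src)) (Sf (K - n) (bondShift (sites_eq F n K h) c')))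
          + conjR (axialT (unitsField (toUField W)) (Site.fibreSite 0 (K - n) (bondShift (sites_eq F n K h) c').src fun _ => (⟨0, pow_pos (F.P K).L_pos (K - n)⟩ : Fin ((F.P K).L ^ (K - n)))) (embIter (K - n) (bondShift (sites_eq F n K h) c').src))⁻¹ (∑ r : Fin (F.P K).d → Fin ((F.P K).L ^ (K - n)), ∑ t ∈ Finset.range ((F.P K).L ^ (K - n)),
        conjR (holT (unitsField (toUField W)) (Site.fibreSite 0 (K - n) (bondShift (sites_eq F n K h) c').src fun _ => (⟨0, pow_pos (F.P K).L_pos (K - n)⟩ : Fin ((F.P K).L ^ (K - n)))) (treeWord fun ν => ((r ν : ℕ) : ℤ))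
            * holT (unitsField (toUField W)) (Site.fibreSite 0 (K - n) (bondShift (sites_eq F n K h) c').src r) (List.replicate t ((bondShift (sites_eq F n K h) c').dir, true)))
          (B ⟨(fun z : Site (F.P K) 0 => z.shift (bondShift (sites_eq F n K h) c').dir)^[t] (Site.fibreSite 0 (K - n) (bondShift (sites_eq F n K h) c').src r), (bondShift (sites_eq F n K h) c').dir⟩)) :=
      smul_eq_three_terms _ _ _ _ _
    have h3 := normSq_le_three ((((((F.L : ℝ) ^ (K - n)) ^ (F.P K).d : ℝ)) : ℂ) • (G (bondShift (sites_eq F n K h) c') - Sf (K - n) (bondShift (sites_eq F n K h) c')))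
      (conjR (axialT (unitsField (toUField W)) (Site.fibreSite 0 (K - n) (bondShift (sites_eq F n K h) c').src fun _ => (⟨0, pow_pos (F.P K).L_pos (K - n)⟩ : Fin ((F.P K).L ^ (K - n)))) (embIter (K - n) (bondShift (sites_eq F n K h) c').src))⁻¹ ((∑ r : Fin (F.P K).d → Fin ((F.P K).L ^ (K - n)), ∑ t ∈ Finset.range ((F.P K).L ^ (K - n)),
        conjR (holT (unitsField (toUField W)) (Site.fibreSite 0 (K - n) (bondShift (sites_eq F n K h) c').src fun _ => (⟨0, pow_pos (F.P K).L_pos (K - n)⟩ : Fin ((F.P K).L ^ (K - n)))) (treeWord fun ν => ((r ν : ℕ) : ℤ))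
            * holT (unitsField (toUField W)) (Site.fibreSite 0 (K - n) (bondShift (sites_eq F n K h) c').src r) (List.replicate t ((bondShift (sites_eq F n K h) c').dir, true)))
          (B ⟨(fun z : Site (F.P K) 0 => z.shift (bondShift (sites_eq F n K h) c').dir)^[t] (Site.fibreSite 0 (K - n) (bondShift (sites_eq F n K h) c').src r), (bondShift (sites_eq F n K h) c').dir⟩)) - (((((F.L : ℝ) ^ (K - n)) ^ (F.P K).d : ℝ)) : ℂ) • conjR (axialT (unitsField (toUField W)) (Site.fibreSite 0 (K - n) (bondShift (sites_eq F n K h) c').src fun _ => (⟨0, pow_pos (F.P K).L_pos (K - n)⟩ : Fin ((F.P K).L ^ (K - n)))) (embIter (K - n) (bondShift (sites_eq F n K h) c').src)) (Sf (K - n) (bondShift (sites_eq F n K h) c'))))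
      (conjR (axialT (unitsField (toUField W)) (Site.fibreSite 0 (K - n) (bondShift (sites_eq F n K h) c').src fun _ => (⟨0, pow_pos (F.P K).L_pos (K - n)⟩ : Fin ((F.P K).L ^ (K - n)))) (embIter (K - n) (bondShift (sites_eq F n K h) c').src))⁻¹ (∑ r : Fin (F.P K).d → Fin ((F.P K).L ^ (K - n)), ∑ t ∈ Finset.range ((F.P K).L ^ (K - n)),
        conjR (holT (unitsField (toUField W)) (Site.fibreSite 0 (K - n) (bondShift (sites_eq F n K h) c').src fun _ => (⟨0, pow_pos (F.P K).L_pos (K - n)⟩ : Fin ((F.P K).L ^ (K - n)))) (treeWord fun ν => ((r ν : ℕ) : ℤ))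
            * holT (unitsField (toUField W)) (Site.fibreSite 0 (K - n) (bondShift (sites_eq F n K h) c').src r) (List.replicate t ((bondShift (sites_eq F n K h) c').dir, true)))
          (B ⟨(fun z : Site (F.P K) 0 => z.shift (bondShift (sites_eq F n K h) c').dir)^[t] (Site.fibreSite 0 (K - n) (bondShift (sites_eq F n K h) c').src r), (bondShift (sites_eq F n K h) c').dir⟩)))
    rw [← hid, norm_conjR hΦi, norm_conjR hΦi, norm_smul, mul_pow, Complex.norm_real, Real.norm_of_nonneg hℓd0.le] at h3
    rw [hR3 c']
    have hpos : (0 : ℝ) < (((F.L : ℝ) ^ (K - n)) ^ (F.P K).d) ^ 2 := by positivity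
    rw [← div_eq_inv_mul, le_div_iff₀ hpos]
    linarith [h3]
  -- ★ sum over `c'`; reindex the global rows to the coarse bonds
  refine (Finset.sum_le_sum fun c' (_ : c' ∈ Finset.univ) => hper c').trans ?_
  rw [← Finset.mul_sum, ← Finset.mul_sum, Finset.sum_add_distrib, Finset.sum_add_distrib]
  have hR2' : ∑ c' : PBond (F.P n) 0, ‖G (bondShift (sites_eq F n K h) c') - Sf (K - n) (bondShift (sites_eq F n K h) c')‖ ^ 2
      ≤ (ρ⁻¹ * (ρ ^ (K - n) * κ * Bc * Real.exp (κ / ρ * Bc))) ^ 2 * ∑ b : PBond (F.P K) 0, ‖B b‖ ^ 2 :=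
    (Fintype.sum_equiv (bondShift (sites_eq F n K h)) _ (fun c : PBond (F.P K) (K - n) => ‖G c - Sf (K - n) c‖ ^ 2) (fun _ => rfl)).trans_le hR2
  have hR1' : ∑ c' : PBond (F.P n) 0, ‖(∑ r : Fin (F.P K).d → Fin ((F.P K).L ^ (K - n)), ∑ t ∈ Finset.range ((F.P K).L ^ (K - n)),
        conjR (holT (unitsField (toUField W)) (Site.fibreSite 0 (K - n) (bondShift (sites_eq F n K h) c').src fun _ => (⟨0, pow_pos (F.P K).L_pos (K - n)⟩ : Fin ((F.P K).L ^ (K - n)))) (treeWord fun ν => ((r ν : ℕ) : ℤ))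
            * holT (unitsField (toUField W)) (Site.fibreSite 0 (K - n) (bondShift (sites_eq F n K h) c').src r) (List.replicate t ((bondShift (sites_eq F n K h) c').dir, true)))
          (B ⟨(fun z : Site (F.P K) 0 => z.shift (bondShift (sites_eq F n K h) c').dir)^[t] (Site.fibreSite 0 (K - n) (bondShift (sites_eq F n K h) c').src r), (bondShift (sites_eq F n K h) c').dir⟩)) - (((((F.L : ℝ) ^ (K - n)) ^ (F.P K).d : ℝ)) : ℂ) • conjR (axialT (unitsField (toUField W)) (Site.fibreSite 0 (K - n) (bondShift (sites_eq F n K h) c').src fun _ => (⟨0, pow_pos (F.P K).L_pos (K - n)⟩ : Fin ((F.P K).L ^ (K - n)))) (embIter (K - n) (bondShift (sites_eq F n K h) c').src)) (Sf (K - n) (bondShift (sites_eq F n K h) c'))‖ ^ 2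
      ≤ 10 ^ 9 * (F.L : ℝ) ^ 4 * ε₀ ^ 2 * ((((F.L : ℝ) ^ (K - n)) ^ (F.P K).d) * (((F.L : ℝ) ^ (K - n)) ^ 2)) * ∑ b : PBond (F.P K) 0, ‖B b‖ ^ 2 :=
    (Fintype.sum_equiv (bondShift (sites_eq F n K h)) _ (fun c : PBond (F.P K) (K - n) => ‖(∑ r : Fin (F.P K).d → Fin ((F.P K).L ^ (K - n)), ∑ t ∈ Finset.range ((F.P K).L ^ (K - n)),
        conjR (holT (unitsField (toUField W)) (Site.fibreSite 0 (K - n) (c).src fun _ => (⟨0, pow_pos (F.P K).L_pos (K - n)⟩ : Fin ((F.P K).L ^ (K - n)))) (treeWord fun ν => ((r ν : ℕ) : ℤ))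
            * holT (unitsField (toUField W)) (Site.fibreSite 0 (K - n) (c).src r) (List.replicate t ((c).dir, true)))
          (B ⟨(fun z : Site (F.P K) 0 => z.shift (c).dir)^[t] (Site.fibreSite 0 (K - n) (c).src r), (c).dir⟩)) - (((((F.L : ℝ) ^ (K - n)) ^ (F.P K).d : ℝ)) : ℂ) • conjR (axialT (unitsField (toUField W)) (Site.fibreSite 0 (K - n) (c).src fun _ => (⟨0, pow_pos (F.P K).L_pos (K - n)⟩ : Fin ((F.P K).L ^ (K - n)))) (embIter (K - n) (c).src)) (Sf (K - n) c)‖ ^ 2) (fun _ => rfl)).trans_le hR1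
  have hT' : ∑ c' : PBond (F.P n) 0, ‖(∑ r : Fin (F.P K).d → Fin ((F.P K).L ^ (K - n)), ∑ t ∈ Finset.range ((F.P K).L ^ (K - n)),
        conjR (holT (unitsField (toUField W)) (Site.fibreSite 0 (K - n) (bondShift (sites_eq F n K h) c').src fun _ => (⟨0, pow_pos (F.P K).L_pos (K - n)⟩ : Fin ((F.P K).L ^ (K - n)))) (treeWord fun ν => ((r ν : ℕ) : ℤ))
            * holT (unitsField (toUField W)) (Site.fibreSite 0 (K - n) (bondShift (sites_eq F n K h) c').src r) (List.replicate t ((bondShift (sites_eq F n K h) c').dir, true)))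
          (B ⟨(fun z : Site (F.P K) 0 => z.shift (bondShift (sites_eq F n K h) c').dir)^[t] (Site.fibreSite 0 (K - n) (bondShift (sites_eq F n K h) c').src r), (bondShift (sites_eq F n K h) c').dir⟩))‖ ^ 2
      ≤ (((F.L : ℝ) ^ (K - n)) ^ (F.P K).d * ((F.L : ℝ) ^ (K - n)) ^ 2) * ∑ b : PBond (F.P K) 0, ‖B b‖ ^ 2 :=
    (Fintype.sum_equiv (bondShift (sites_eq F n K h)) _ (fun c : PBond (F.P K) (K - n) => ‖(∑ r : Fin (F.P K).d → Fin ((F.P K).L ^ (K - n)), ∑ t ∈ Finset.range ((F.P K).L ^ (K - n)),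
        conjR (holT (unitsField (toUField W)) (Site.fibreSite 0 (K - n) (c).src fun _ => (⟨0, pow_pos (F.P K).L_pos (K - n)⟩ : Fin ((F.P K).L ^ (K - n)))) (treeWord fun ν => ((r ν : ℕ) : ℤ))
            * holT (unitsField (toUField W)) (Site.fibreSite 0 (K - n) (c).src r) (List.replicate t ((c).dir, true)))
          (B ⟨(fun z : Site (F.P K) 0 => z.shift (c).dir)^[t] (Site.fibreSite 0 (K - n) (c).src r), (c).dir⟩))‖ ^ 2) (fun _ => rfl)).trans_le hT
  have hX1 : ∑ c' : PBond (F.P n) 0, ‖(((((F.L : ℝ) ^ (K - n)) ^ (F.P K).d : ℝ)) : ℂ) • (G (bondShift (sites_eq F n K h) c') - Sf (K - n) (bondShift (sites_eq F n K h) c'))‖ ^ 2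
      = (((F.L : ℝ) ^ (K - n)) ^ (F.P K).d) ^ 2 * ∑ c' : PBond (F.P n) 0, ‖G (bondShift (sites_eq F n K h) c') - Sf (K - n) (bondShift (sites_eq F n K h) c')‖ ^ 2 := by
    rw [Finset.mul_sum]
    refine Finset.sum_congr rfl fun c' _ => ?_
    rw [norm_smul, mul_pow, Complex.norm_real, Real.norm_of_nonneg hℓd0.le]
  rw [hX1]
  -- assemble the numbers
  have hN : 0 ≤ ∑ b : PBond (F.P K) 0, ‖B b‖ ^ 2 := by positivity
  have hG2 : (((F.L : ℝ) ^ (K - n)) ^ (F.P K).d) ^ 2 * ∑ c' : PBond (F.P n) 0, ‖G (bondShift (sites_eq F n K h) c') - Sf (K - n) (bondShift (sites_eq F n K h) c')‖ ^ 2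
      ≤ (((F.L : ℝ) ^ (K - n)) ^ (F.P K).d) ^ 2 * ((ρ⁻¹ * (ρ ^ (K - n) * κ * Bc * Real.exp (κ / ρ * Bc))) ^ 2 * ∑ b : PBond (F.P K) 0, ‖B b‖ ^ 2) :=
    mul_le_mul_of_nonneg_left hR2' (by positivity)
  have hbcN := mul_le_mul_of_nonneg_right hbc hN
  have hkey : 3 * ((((F.L : ℝ) ^ (K - n)) ^ (F.P K).d) ^ 2 * ∑ c' : PBond (F.P n) 0, ‖G (bondShift (sites_eq F n K h) c') - Sf (K - n) (bondShift (sites_eq F n K h) c')‖ ^ 2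
        + ∑ c' : PBond (F.P n) 0, ‖(∑ r : Fin (F.P K).d → Fin ((F.P K).L ^ (K - n)), ∑ t ∈ Finset.range ((F.P K).L ^ (K - n)),
        conjR (holT (unitsField (toUField W)) (Site.fibreSite 0 (K - n) (bondShift (sites_eq F n K h) c').src fun _ => (⟨0, pow_pos (F.P K).L_pos (K - n)⟩ : Fin ((F.P K).L ^ (K - n)))) (treeWord fun ν => ((r ν : ℕ) : ℤ))
            * holT (unitsField (toUField W)) (Site.fibreSite 0 (K - n) (bondShift (sites_eq F n K h) c').src r) (List.replicate t ((bondShift (sites_eq F n K h) c').dir, true)))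
          (B ⟨(fun z : Site (F.P K) 0 => z.shift (bondShift (sites_eq F n K h) c').dir)^[t] (Site.fibreSite 0 (K - n) (bondShift (sites_eq F n K h) c').src r), (bondShift (sites_eq F n K h) c').dir⟩)) - (((((F.L : ℝ) ^ (K - n)) ^ (F.P K).d : ℝ)) : ℂ) • conjR (axialT (unitsField (toUField W)) (Site.fibreSite 0 (K - n) (bondShift (sites_eq F n K h) c').src fun _ => (⟨0, pow_pos (F.P K).L_pos (K - n)⟩ : Fin ((F.P K).L ^ (K - n)))) (embIter (K - n) (bondShift (sites_eq F n K h) c').src)) (Sf (K - n) (bondShift (sites_eq F n K h) c'))‖ ^ 2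
        + ∑ c' : PBond (F.P n) 0, ‖(∑ r : Fin (F.P K).d → Fin ((F.P K).L ^ (K - n)), ∑ t ∈ Finset.range ((F.P K).L ^ (K - n)),
        conjR (holT (unitsField (toUField W)) (Site.fibreSite 0 (K - n) (bondShift (sites_eq F n K h) c').src fun _ => (⟨0, pow_pos (F.P K).L_pos (K - n)⟩ : Fin ((F.P K).L ^ (K - n)))) (treeWord fun ν => ((r ν : ℕ) : ℤ))
            * holT (unitsField (toUField W)) (Site.fibreSite 0 (K - n) (bondShift (sites_eq F n K h) c').src r) (List.replicate t ((bondShift (sites_eq F n K h) c').dir, true)))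
          (B ⟨(fun z : Site (F.P K) 0 => z.shift (bondShift (sites_eq F n K h) c').dir)^[t] (Site.fibreSite 0 (K - n) (bondShift (sites_eq F n K h) c').src r), (bondShift (sites_eq F n K h) c').dir⟩))‖ ^ 2)
      ≤ 3 * (1 + 10 ^ 10 * (F.L : ℝ) ^ 10 * ε₀ ^ 2) * ((((F.L : ℝ) ^ (K - n)) ^ (F.P K).d) * (((F.L : ℝ) ^ (K - n)) ^ 2)) * ∑ b : PBond (F.P K) 0, ‖B b‖ ^ 2 := by
    have hS1 : 3 * ((((F.L : ℝ) ^ (K - n)) ^ (F.P K).d) ^ 2 * ∑ c' : PBond (F.P n) 0, ‖G (bondShift (sites_eq F n K h) c') - Sf (K - n) (bondShift (sites_eq F n K h) c')‖ ^ 2)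
        ≤ 3 / 16 * ((10 ^ 11 * (F.L : ℝ) ^ 10 - 16 * 10 ^ 9 * (F.L : ℝ) ^ 4) * (ε₀ ^ 2 * ((((F.L : ℝ) ^ (K - n)) ^ (F.P K).d) * (((F.L : ℝ) ^ (K - n)) ^ 2))) * (∑ b : PBond (F.P K) 0, ‖B b‖ ^ 2)) := by
      linarith [hG2, hbcN]
    have hP10 : 0 ≤ (F.L : ℝ) ^ 10 * (ε₀ ^ 2 * ((((F.L : ℝ) ^ (K - n)) ^ (F.P K).d) * (((F.L : ℝ) ^ (K - n)) ^ 2)) * (∑ b : PBond (F.P K) 0, ‖B b‖ ^ 2)) := by positivity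
    have hP4 : 0 ≤ (F.L : ℝ) ^ 4 * (ε₀ ^ 2 * ((((F.L : ℝ) ^ (K - n)) ^ (F.P K).d) * (((F.L : ℝ) ^ (K - n)) ^ 2)) * (∑ b : PBond (F.P K) 0, ‖B b‖ ^ 2)) := by positivity
    nlinarith [hS1, hR1', hT', hP10, hP4]
  have hinv : ((((F.L : ℝ) ^ (K - n)) ^ (F.P K).d) ^ 2)⁻¹ * (3 * (1 + 10 ^ 10 * (F.L : ℝ) ^ 10 * ε₀ ^ 2) * ((((F.L : ℝ) ^ (K - n)) ^ (F.P K).d) * (((F.L : ℝ) ^ (K - n)) ^ 2)) * ∑ b : PBond (F.P K) 0, ‖B b‖ ^ 2)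
      = 3 * (1 + 10 ^ 10 * (F.L : ℝ) ^ 10 * ε₀ ^ 2) * (((F.L : ℝ) ^ (K - n)) ^ 2 / ((F.L : ℝ) ^ (K - n)) ^ (F.P K).d) * ∑ b : PBond (F.P K) 0, ‖B b‖ ^ 2 := by
    field_simp
  rw [← hinv]
  exact mul_le_mul_of_nonneg_left hkey (by positivity)

/-- The window makes the curvature constant harmless: `10¹⁰L⁶ε₀ ≤ 1 ⟹ 10¹⁰L¹⁰ε₀² ≤ 1` (`L ≥ 3`), so `3·(1 + 10¹⁰L¹⁰ε₀²) ≤ 6`. [cite: Balaban1985Variational, (2) p.278] -/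
theorem ten10_L10_sq_le_one {ε₀ : ℝ} (hε₀ : 0 < ε₀) (hε : 10 ^ 10 * (F.L : ℝ) ^ 6 * ε₀ ≤ 1) : 10 ^ 10 * (F.L : ℝ) ^ 10 * ε₀ ^ 2 ≤ 1 := by
  have hL3 : (3 : ℝ) ≤ F.L := by
    have h3 : 3 ≤ F.L := by obtain ⟨a, ha⟩ := F.hL.1; have := F.hL.2; omega
    exact_mod_cast h3
  have hL1 : (1 : ℝ) ≤ F.L := by linarith
  have hL4 : (1 : ℝ) ≤ (F.L : ℝ) ^ 4 := one_le_pow₀ hL1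
  have hL6 : (0 : ℝ) < (F.L : ℝ) ^ 6 := by positivity
  -- `ε₀ ≤ 1∕(10¹⁰L⁶)` and `L⁴ε₀ ≤ L⁴∕(10¹⁰L⁶) ≤ 1`
  have h1 : (F.L : ℝ) ^ 4 * ε₀ ≤ 1 := by
    have : (F.L : ℝ) ^ 4 * ε₀ * (10 ^ 10 * (F.L : ℝ) ^ 2) = 10 ^ 10 * (F.L : ℝ) ^ 6 * ε₀ := by ring
    have h2 : (1 : ℝ) ≤ 10 ^ 10 * (F.L : ℝ) ^ 2 := by nlinarith
    nlinarith [hε₀.le]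
  calc 10 ^ 10 * (F.L : ℝ) ^ 10 * ε₀ ^ 2 = (10 ^ 10 * (F.L : ℝ) ^ 6 * ε₀) * ((F.L : ℝ) ^ 4 * ε₀) := by ring
    _ ≤ 1 * 1 := mul_le_mul hε h1 (by positivity) zero_le_one
    _ = 1 := one_mul 1

/-- ★★ The same with a bare number: `Σ_{c'} |QTwS U₀ B c'|² ≤ 6·(ℓ²∕ℓ^d)·Σ_b |B b|²` on 𝔰𝔲(2) fields. [cite: Balaban1985BackgroundPropagators, (3.13)-(3.15) p.393; Balaban1984PropagatorsI, (1.18) p.20] -/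
theorem sum_normSq_QTwS_le_six_of_su2 {ε₀ : ℝ} (hε₀ : 0 < ε₀) (hε : 10 ^ 10 * (F.L : ℝ) ^ 6 * ε₀ ≤ 1) (hε12 : 10 ^ 12 * (F.L : ℝ) ^ 3 * ε₀ ≤ 1)
    (W : GaugeField (F.P K) 0 (Matrix.specialUnitaryGroup (Fin 2) ℂ)) (hreg : RegPr F n K ε₀ W)
    (B : PBond (F.P K) 0 → Matrix (Fin 2) (Fin 2) ℂ) (hsk : ∀ b, (B b)ᴴ = -B b) (htr : ∀ b, (B b).trace = 0) :
    ∑ c' : PBond (F.P n) 0, ‖QTwS F n K h W B c'‖ ^ 2 ≤ 6 * (((F.L : ℝ) ^ (K - n)) ^ 2 / ((F.L : ℝ) ^ (K - n)) ^ (F.P K).d) * ∑ b : PBond (F.P K) 0, ‖B b‖ ^ 2 := by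
  have h1 := sum_normSq_QTwS_le_of_su2 F n K h hε₀ hε hε12 W hreg B hsk htr
  have h2 := ten10_L10_sq_le_one F hε₀ hε
  have hL0 : (0 : ℝ) < F.L := by
    have h3 : 3 ≤ F.L := by obtain ⟨a, ha⟩ := F.hL.1; have := F.hL.2; omega
    have : (3 : ℝ) ≤ F.L := by exact_mod_cast h3
    linarith
  have hP : 0 ≤ (((F.L : ℝ) ^ (K - n)) ^ 2 / ((F.L : ℝ) ^ (K - n)) ^ (F.P K).d) * ∑ b : PBond (F.P K) 0, ‖B b‖ ^ 2 := by positivity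
  nlinarith [h1, h2, hP]

end Curved

/-! ## §3 All `M₂(ℂ)`-valued fields, Hilbert–Schmidt currency -/

section AllFields

variable (h : n ≤ K)

/-- ★ **THE SCALAR SECTOR IS FLAT**: `Σ_{c'} Σ_{jk} |(QTwS U₀ (τ•1) c')_{jk}|² ≤ (ℓ²∕ℓ^d)·Σ_b Σ_{jk} |(τ b•1)_{jk}|²` at `RegPr` ((Q-b) ✓`QTwS_smul_one_eq_QTwS_one_of_regPr` + §1).
[cite: Balaban1984PropagatorsI, (1.18) p.20; Balaban1985Averaging, (125)-(127) p.36] -/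
theorem sum_normSq_entries_QTwS_smul_one_le {ε₀ : ℝ} (hε₀ : 0 < ε₀) (hε12 : 10 ^ 12 * (F.L : ℝ) ^ 3 * ε₀ ≤ 1)
    (W : GaugeField (F.P K) 0 (Matrix.specialUnitaryGroup (Fin 2) ℂ)) (hreg : RegPr F n K ε₀ W) (τ : PBond (F.P K) 0 → ℂ) :
    ∑ c' : PBond (F.P n) 0, ∑ j, ∑ k, ‖(QTwS F n K h W (fun b => τ b • (1 : Matrix (Fin 2) (Fin 2) ℂ)) c') j k‖ ^ 2
      ≤ (((F.L : ℝ) ^ (K - n)) ^ 2 / ((F.L : ℝ) ^ (K - n)) ^ (F.P K).d) * ∑ b : PBond (F.P K) 0, ∑ j, ∑ k, ‖(τ b • (1 : Matrix (Fin 2) (Fin 2) ℂ)) j k‖ ^ 2 := by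
  have hc := QTwS_apply_smul_one_of_regPr F h hε₀ hε12 W hreg τ
  have h1 := QTwS_smul_one_eq_QTwS_one_of_regPr F h hε₀ hε12 W hreg τ
  -- both sides are twice the operator-norm currency
  have hL : ∀ c' : PBond (F.P n) 0, ∑ j, ∑ k, ‖(QTwS F n K h W (fun b => τ b • (1 : Matrix (Fin 2) (Fin 2) ℂ)) c') j k‖ ^ 2 = 2 * ‖QTwS F n K h (1 : GaugeField (F.P K) 0 (Matrix.specialUnitaryGroup (Fin 2) ℂ)) (fun b => τ b • (1 : Matrix (Fin 2) (Fin 2) ℂ)) c'‖ ^ 2 := by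
    intro c'
    rw [← h1, hc]
    dsimp only
    rw [sum_normSq_smul_one, norm_smul, norm_one, mul_one]
  have hR : ∀ b : PBond (F.P K) 0, ∑ j, ∑ k, ‖(τ b • (1 : Matrix (Fin 2) (Fin 2) ℂ)) j k‖ ^ 2 = 2 * ‖τ b • (1 : Matrix (Fin 2) (Fin 2) ℂ)‖ ^ 2 := by
    intro b
    rw [sum_normSq_smul_one, norm_smul, norm_one, mul_one]
  simp only [hL, hR]
  rw [← Finset.mul_sum, ← Finset.mul_sum]
  have h2 := sum_normSq_QTwS_one_le F n K h (fun b => τ b • (1 : Matrix (Fin 2) (Fin 2) ℂ))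
  nlinarith [h2]

set_option maxHeartbeats 400000 in
/-- ★★ **THE `ℓ²` BOUND OF `QTwS U₀` ON ALL `M₂(ℂ)`-VALUED FIELDS, HILBERT–SCHMIDT CURRENCY**: `RegPr`, `10¹⁰L⁶ε₀ ≤ 1`, `10¹²L³ε₀ ≤ 1` ⟹
`Σ_{c'} Σ_{jk} |(QTwS U₀ Y c')_{jk}|² ≤ 36·(ℓ²∕ℓ^d)·Σ_b Σ_{jk} |Y(b)_{jk}|²` (sectors `Y = Y₁ + I•Y₂ + τ•1`; §2 twice, the flat scalar sector, `|X|² ≤ Σ|X_{jk}|² ≤ 2|X|²`, Pythagoras).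
[cite: Balaban1985BackgroundPropagators, (3.13)-(3.15) p.393, Thm 3.11 p.416; Balaban1985Averaging, (18)-(20) p.21, Prop. 3 (124)-(126) p.36; Balaban1984PropagatorsI, (1.18) p.20] -/
theorem sum_normSq_entries_QTwS_le {ε₀ : ℝ} (hε₀ : 0 < ε₀) (hε : 10 ^ 10 * (F.L : ℝ) ^ 6 * ε₀ ≤ 1) (hε12 : 10 ^ 12 * (F.L : ℝ) ^ 3 * ε₀ ≤ 1)
    (W : GaugeField (F.P K) 0 (Matrix.specialUnitaryGroup (Fin 2) ℂ)) (hreg : RegPr F n K ε₀ W) (Y : PBond (F.P K) 0 → Matrix (Fin 2) (Fin 2) ℂ) :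
    ∑ c' : PBond (F.P n) 0, ∑ j, ∑ k, ‖(QTwS F n K h W Y c') j k‖ ^ 2
      ≤ 36 * (((F.L : ℝ) ^ (K - n)) ^ 2 / ((F.L : ℝ) ^ (K - n)) ^ (F.P K).d) * ∑ b : PBond (F.P K) 0, ∑ j, ∑ k, ‖Y b j k‖ ^ 2 := by
  classical
  have hL0 : (0 : ℝ) < F.L := by
    have h3 : 3 ≤ F.L := by obtain ⟨a, ha⟩ := F.hL.1; have := F.hL.2; omega
    have : (3 : ℝ) ≤ F.L := by exact_mod_cast h3
    linarith
  set ρ : ℝ := (((F.L : ℝ) ^ (K - n)) ^ 2 / ((F.L : ℝ) ^ (K - n)) ^ (F.P K).d) with hρ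
  have hρ0 : 0 ≤ ρ := by positivity
  obtain ⟨Y₁, Y₂, τ, hY₁, hY₂, hY⟩ := exists_sector_fields Y
  have hsk₁ : ∀ b, (Y₁ b)ᴴ = -Y₁ b := fun b => by rw [← Matrix.star_eq_conjTranspose]; exact (hY₁ b).1
  have hsk₂ : ∀ b, (Y₂ b)ᴴ = -Y₂ b := fun b => by rw [← Matrix.star_eq_conjTranspose]; exact (hY₂ b).1
  have h1 := sum_normSq_QTwS_le_six_of_su2 F n K h hε₀ hε hε12 W hreg Y₁ hsk₁ (fun b => (hY₁ b).2)
  have h2 := sum_normSq_QTwS_le_six_of_su2 F n K h hε₀ hε hε12 W hreg Y₂ hsk₂ (fun b => (hY₂ b).2)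
  have h0 := sum_normSq_entries_QTwS_smul_one_le F n K h hε₀ hε12 W hreg τ
  rw [← hρ] at h1 h2 h0
  -- the decomposition of `QTwS W Y c'`
  have hYf : Y = Y₁ + Complex.I • Y₂ + (fun b => τ b • (1 : Matrix (Fin 2) (Fin 2) ℂ)) := by
    rw [hY]; funext b; simp only [Pi.add_apply, Pi.smul_apply]
  have hdec : ∀ c' : PBond (F.P n) 0, QTwS F n K h W Y c' = QTwS F n K h W Y₁ c' + Complex.I • QTwS F n K h W Y₂ c' + QTwS F n K h W (fun b => τ b • (1 : Matrix (Fin 2) (Fin 2) ℂ)) c' := by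
    intro c'
    conv_lhs => rw [hYf]
    rw [map_add, map_add, map_smul]
    simp only [Pi.add_apply, Pi.smul_apply]
  -- op ≤ HS on the sector fields, Pythagoras on `Y`
  have hA₁ : ∑ b : PBond (F.P K) 0, ‖Y₁ b‖ ^ 2 ≤ ∑ b : PBond (F.P K) 0, ∑ j, ∑ k, ‖Y₁ b j k‖ ^ 2 :=
    Finset.sum_le_sum fun b _ => MatrixNorms.opNorm_sq_le_sum_norm_sq (Y₁ b)
  have hA₂ : ∑ b : PBond (F.P K) 0, ‖Y₂ b‖ ^ 2 ≤ ∑ b : PBond (F.P K) 0, ∑ j, ∑ k, ‖Y₂ b j k‖ ^ 2 :=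
    Finset.sum_le_sum fun b _ => MatrixNorms.opNorm_sq_le_sum_norm_sq (Y₂ b)
  have hPy : ∑ b : PBond (F.P K) 0, ∑ j, ∑ k, ‖Y₁ b j k‖ ^ 2 + ∑ b : PBond (F.P K) 0, ∑ j, ∑ k, ‖Y₂ b j k‖ ^ 2
      + ∑ b : PBond (F.P K) 0, ∑ j, ∑ k, ‖(τ b • (1 : Matrix (Fin 2) (Fin 2) ℂ)) j k‖ ^ 2 = ∑ b : PBond (F.P K) 0, ∑ j, ∑ k, ‖Y b j k‖ ^ 2 := by
    rw [← Finset.sum_add_distrib, ← Finset.sum_add_distrib]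
    refine Finset.sum_congr rfl fun b _ => ?_
    have hb : Y b = Y₁ b + Complex.I • Y₂ b + τ b • (1 : Matrix (Fin 2) (Fin 2) ℂ) := by rw [hY]
    rw [hb, sum_normSq_entries_sectors (hY₁ b) (hY₂ b) (τ b)]
  calc ∑ c' : PBond (F.P n) 0, ∑ j, ∑ k, ‖(QTwS F n K h W Y c') j k‖ ^ 2
      = ∑ c' : PBond (F.P n) 0, ∑ j, ∑ k, ‖(QTwS F n K h W Y₁ c' + Complex.I • QTwS F n K h W Y₂ c' + QTwS F n K h W (fun b => τ b • (1 : Matrix (Fin 2) (Fin 2) ℂ)) c') j k‖ ^ 2 := by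
          refine Finset.sum_congr rfl fun c' _ => ?_; rw [hdec c']
    _ ≤ ∑ c' : PBond (F.P n) 0, 3 * (∑ j, ∑ k, ‖(QTwS F n K h W Y₁ c') j k‖ ^ 2 + ∑ j, ∑ k, ‖(Complex.I • QTwS F n K h W Y₂ c') j k‖ ^ 2
          + ∑ j, ∑ k, ‖(QTwS F n K h W (fun b => τ b • (1 : Matrix (Fin 2) (Fin 2) ℂ)) c') j k‖ ^ 2) :=
          Finset.sum_le_sum fun c' _ => sum_normSq_add_three_le _ _ _
    _ = 3 * (∑ c' : PBond (F.P n) 0, ∑ j, ∑ k, ‖(QTwS F n K h W Y₁ c') j k‖ ^ 2 + ∑ c' : PBond (F.P n) 0, ∑ j, ∑ k, ‖(QTwS F n K h W Y₂ c') j k‖ ^ 2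
          + ∑ c' : PBond (F.P n) 0, ∑ j, ∑ k, ‖(QTwS F n K h W (fun b => τ b • (1 : Matrix (Fin 2) (Fin 2) ℂ)) c') j k‖ ^ 2) := by
          rw [← Finset.mul_sum, Finset.sum_add_distrib, Finset.sum_add_distrib]
          simp only [sum_normSq_I_smul]
    _ ≤ 3 * (2 * ∑ c' : PBond (F.P n) 0, ‖QTwS F n K h W Y₁ c'‖ ^ 2 + 2 * ∑ c' : PBond (F.P n) 0, ‖QTwS F n K h W Y₂ c'‖ ^ 2
          + ∑ c' : PBond (F.P n) 0, ∑ j, ∑ k, ‖(QTwS F n K h W (fun b => τ b • (1 : Matrix (Fin 2) (Fin 2) ℂ)) c') j k‖ ^ 2) := by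
          gcongr
          · rw [Finset.mul_sum]; exact Finset.sum_le_sum fun c' _ => sum_norm_sq_le_two_mul_opNorm_sq _
          · rw [Finset.mul_sum]; exact Finset.sum_le_sum fun c' _ => sum_norm_sq_le_two_mul_opNorm_sq _
    _ ≤ 3 * (2 * (6 * ρ * ∑ b : PBond (F.P K) 0, ‖Y₁ b‖ ^ 2) + 2 * (6 * ρ * ∑ b : PBond (F.P K) 0, ‖Y₂ b‖ ^ 2)
          + ρ * ∑ b : PBond (F.P K) 0, ∑ j, ∑ k, ‖(τ b • (1 : Matrix (Fin 2) (Fin 2) ℂ)) j k‖ ^ 2) := by gcongr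
    _ ≤ 3 * (2 * (6 * ρ * ∑ b : PBond (F.P K) 0, ∑ j, ∑ k, ‖Y₁ b j k‖ ^ 2) + 2 * (6 * ρ * ∑ b : PBond (F.P K) 0, ∑ j, ∑ k, ‖Y₂ b j k‖ ^ 2)
          + ρ * ∑ b : PBond (F.P K) 0, ∑ j, ∑ k, ‖(τ b • (1 : Matrix (Fin 2) (Fin 2) ℂ)) j k‖ ^ 2) := by gcongr
    _ ≤ 36 * ρ * (∑ b : PBond (F.P K) 0, ∑ j, ∑ k, ‖Y₁ b j k‖ ^ 2 + ∑ b : PBond (F.P K) 0, ∑ j, ∑ k, ‖Y₂ b j k‖ ^ 2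
          + ∑ b : PBond (F.P K) 0, ∑ j, ∑ k, ‖(τ b • (1 : Matrix (Fin 2) (Fin 2) ℂ)) j k‖ ^ 2) := by
          have hτ0 : 0 ≤ ∑ b : PBond (F.P K) 0, ∑ j, ∑ k, ‖(τ b • (1 : Matrix (Fin 2) (Fin 2) ℂ)) j k‖ ^ 2 := by positivity
          nlinarith [mul_nonneg hρ0 hτ0]
    _ = 36 * ρ * ∑ b : PBond (F.P K) 0, ∑ j, ∑ k, ‖Y b j k‖ ^ 2 := by rw [hPy]

end AllFields

end Summit.QuantumFields.YangMills.Theorems.Prop7QTwSEllTwoBound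

end
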